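/-
Copyright (c) 2026 the pub-hodgecm-mathlib formalisation cell (harness21).  Prover seat hodgecm-mathlib-K2Liu-p08 (g2), Track B «K2-LIT»,
#184♮ = hLiu418 = `stmt-HodgeConjecture-24832`; LEAD F0P6-plan (g12) RULING «M-156n» (3) 2026-09-04T08:09:40Z + «=» 08:12:06Z (G7-C = «THE FACE
Φ9 CONSUMES», (o1) BY VALUE over ANY block decomposition), K2E5-plan (g6) «=» 08:12:41Z; census `K2/K2Liu-p08/g2/CENSUS-G7G8-HeightVsIwasawa.K2Liu-p08-g2.md`.
-/
import Summits.HodgeConjecture.HodgeConjecture.Theorems.K2LiuLatticeTraceDecaySumBound     -- ★ G7-C lattice half (+ ★ G7-B, ★ G7-A through it)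
import Summits.HodgeConjecture.HodgeConjecture.Theorems.K2LiuArchOneParameterOrbitHeight     -- ★ `exists_pos_height_mul_le` (height algebra)
import HarnessLib

/-!
# Crux `HLiu418`, Road Φ, gap G7-C: THE HEIGHT-vs-IWASAWA LATTICE-SUM BOUND (the face Φ9-CORE consumes)

Cell `hodgecm-mathlib`, crux item hLiu418 = `stmt-HodgeConjecture-24832`; LEAD F0P6-plan (g12) (M-156n (3)), co-dealer K2E5-plan (g6).  THEOREMS ONLY (no `def`,
no instance, no notation, no named-fact hypothesis, no `sorry`); lane `--supports stmt-HodgeConjecture-24832 --as helper` (count-neutral).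
Consumer: Φ9-CORE (K2Liu-p10 (g2)) — its `hmaj` binder «ONE locally-uniform summable majorant `Σ_S m_S(s) ≤ C(z)·‖h‖^A`» is fed, on the archimedean
side, by Φ6b's per-term bound `‖W_{S,w}(f_w,s)(n(x)m(y)k)‖ ≤ C(K)(1+‖S‖)^N (det yyᴴ)^{−A} e^{−2π Re tr(S·yyᴴ)}` and THIS file's two inequalities.

THE STATEMENT (general unitary frame `(F, E, c, N, J)`, complex places `w σ` fixed by `c ≠ 1`, a block size `p` with `p ⊕ p ≃ Fin N`, frames `T σ, T σ⁻¹` and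
movers `κ σ, κ σ⁻¹` with entries `≤ M` — ALL BY VALUE; `hdec : T σ · (h_∞)~_{w σ} · T σ⁻¹ = [y σ, b σ; 0, d σ] · κ σ` is ANY block decomposition):
* **`latticeSum_le_height`** — `∃ C A′, ∀ h y b d κ κ′, … → hdec → Σ'_{x ∈ Λ, x ≻ 0} ∏_σ e^{−2π Re tr(x_σ · y_σ y_σᴴ)} (1 + Re tr x_σ)^N ≤ C·‖h‖^{A′}`;
* **`detFactor_le_height`** — `∃ C A′, ∀ …, hdec → ∏_σ (Re det(y_σ y_σᴴ))^{−A} ≤ C·‖h‖^{A′}` (`A` of either sign);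
* `latticeSum_mul_detFactor_le_height` — the product of the two.
Road: ★ G7-B `norm_archAt_archPart_apply_le` (entries of `(h_∞)_w^{±1} ≤ ‖h‖`), `block_entry_bounds` (§1: entries of `y_σ^{±1} ≤ c‖h‖`, `c = |p⊕p|³M³`),
★ G7-B `posSemidef_mul_conjTranspose_sub_smul` (`y yᴴ ⪰ ε(h)•1`, `ε(h)⁻¹ = (|p|(c‖h‖+1))² ≤ c′‖h‖²` thanks to the height floor §2), the general-size lattice
bound ★ `K2LiuLatticeTraceDecaySumBound.exists_tsum_lattice_posDef_trace_le` (split off this file), and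
`rpow_neg_re_det_le` (`(Re det(yyᴴ))^{−A} = ‖det y‖^{−2A} ≤ ((|p|!·R^{|p|})²)^{|A|}`, ★ G7-B `norm_det_le_of_entry_le` on `y` and `y⁻¹`).
[BorelJacquet1979, §1.2, §4.1] [MoeglinWaldspurger1995, I.2.2, II.1.5] [Shimura1997, §A3].
HONEST LABEL.  Count-neutral helper; `HC_CM` is proved only modulo the 7 printed citations (2 remaining named inputs: hLiu418 = `stmt-HodgeConjecture-24832`,
h413 = `stmt-HodgeConjecture-24833`) until rung 0 closes.
-/

set_option autoImplicit false
set_option linter.dupNamespace false -- the mandated namespace repeats `HodgeConjecture.HodgeConjecture`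

noncomputable section

open scoped BigOperators ComplexOrder Matrix
-- `Classical` is needed to see the Mathlib normed-ring instances on `mixedSpace E` (note H5 of `AdelicGLnGlue`)
open scoped Classical
open Finset

namespace Summit.HodgeConjecture.HodgeConjecture.Cruxes.HLiu418.K2LiuIwasawaHeightLatticeSumBound

open Summit.HodgeConjecture.HodgeConjecture.Cruxes.HLiu418.K2LiuArchBlockHeightBound
open Summit.HodgeConjecture.HodgeConjecture.Cruxes.HLiu418.K2LiuLatticeTraceDecaySumBound

/-! ## §1 Per place: block entries, the positive-definiteness floor and the determinant factor -/

section Place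

variable {p : Type*} [Fintype p] [DecidableEq p] {N : ℕ}

/-- **ENTRIES OF THE DIAGONAL BLOCK AND OF ITS INVERSE**: if `T·g̃·T⁻¹ = [y b; 0 d]·κ` with `g̃ = reindex g`, the entries of `g, g⁻¹` are `≤ H` and those of
`T, T⁻¹, κ, κ⁻¹` are `≤ M` (`M, H ≥ 0`), then the entries of `y` and `y⁻¹` are `≤ |p ⊕ p|³ M³ · H`, and `y y⁻¹ = 1`. [folklore] -/
theorem block_entry_bounds (r : p ⊕ p ≃ Fin N) {T Tinv κ κ' : Matrix (p ⊕ p) (p ⊕ p) ℂ} (hT : T * Tinv = 1) (hT' : Tinv * T = 1)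
    (hκ : κ * κ' = 1) (hκ' : κ' * κ = 1) {M : ℝ} (hM : 0 ≤ M)
    (hTe : ∀ i j, ‖T i j‖ ≤ M) (hTe' : ∀ i j, ‖Tinv i j‖ ≤ M) (hκe : ∀ i j, ‖κ i j‖ ≤ M) (hκe' : ∀ i j, ‖κ' i j‖ ≤ M)
    {g g' : Matrix (Fin N) (Fin N) ℂ} (hg : g * g' = 1) {H : ℝ} (hH : 0 ≤ H) (hge : ∀ i j, ‖g i j‖ ≤ H) (hge' : ∀ i j, ‖g' i j‖ ≤ H)
    {y b d : Matrix p p ℂ} (hdec : T * Matrix.reindex r.symm r.symm g * Tinv = Matrix.fromBlocks y b 0 d * κ) :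
    (∀ i j, ‖y i j‖ ≤ (Fintype.card (p ⊕ p) : ℝ) ^ 3 * M ^ 3 * H) ∧ (∀ i j, ‖y⁻¹ i j‖ ≤ (Fintype.card (p ⊕ p) : ℝ) ^ 3 * M ^ 3 * H) ∧ y * y⁻¹ = 1 := by
  set m : ℝ := (Fintype.card (p ⊕ p) : ℝ) with hm
  set gt : Matrix (p ⊕ p) (p ⊕ p) ℂ := Matrix.reindex r.symm r.symm g with hgt
  set gt' : Matrix (p ⊕ p) (p ⊕ p) ℂ := Matrix.reindex r.symm r.symm g' with hgt'
  have hgg : gt * gt' = 1 := by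
    rw [hgt, hgt', Matrix.reindex_apply, Matrix.reindex_apply, Equiv.symm_symm, Matrix.submatrix_mul_equiv, hg, Matrix.submatrix_one_equiv]
  have hgte : ∀ i j, ‖gt i j‖ ≤ H := fun i j => by rw [hgt, Matrix.reindex_apply, Matrix.submatrix_apply]; exact hge _ _
  have hgte' : ∀ i j, ‖gt' i j‖ ≤ H := fun i j => by rw [hgt', Matrix.reindex_apply, Matrix.submatrix_apply]; exact hge' _ _
  -- `X = [y b; 0 d] = T g̃ T⁻¹ κ'` and its right inverse `X' = κ T g̃' T⁻¹`
  set X : Matrix (p ⊕ p) (p ⊕ p) ℂ := Matrix.fromBlocks y b 0 d with hX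
  have hXeq : X = T * gt * Tinv * κ' := by rw [hX, ← Matrix.mul_one (Matrix.fromBlocks y b 0 d), ← hκ, ← Matrix.mul_assoc, ← hdec]
  set X' : Matrix (p ⊕ p) (p ⊕ p) ℂ := κ * (T * gt' * Tinv) with hX'
  have hXX' : X * X' = 1 := by
    rw [hXeq, hX']
    calc T * gt * Tinv * κ' * (κ * (T * gt' * Tinv)) = T * gt * (Tinv * ((κ' * κ) * T)) * gt' * Tinv := by
          simp only [Matrix.mul_assoc]
      _ = 1 := by rw [hκ', Matrix.one_mul, hT', Matrix.mul_one, Matrix.mul_assoc T, hgg, Matrix.mul_one, hT]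
  -- entry bounds for `X` and `X'`
  have h1 : ∀ i j, ‖(T * gt) i j‖ ≤ m * (M * H) := norm_mul_apply_le hM hTe hgte
  have h2 : ∀ i j, ‖(T * gt * Tinv) i j‖ ≤ m * (m * (M * H) * M) := norm_mul_apply_le (by positivity) h1 hTe'
  have hXe : ∀ i j, ‖X i j‖ ≤ m ^ 3 * M ^ 3 * H := fun i j => by
    rw [hXeq]
    calc ‖(T * gt * Tinv * κ') i j‖ ≤ m * (m * (m * (M * H) * M) * M) := norm_mul_apply_le (by positivity) h2 hκe' i j
      _ = m ^ 3 * M ^ 3 * H := by ring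
  have h1' : ∀ i j, ‖(T * gt') i j‖ ≤ m * (M * H) := norm_mul_apply_le hM hTe hgte'
  have h2' : ∀ i j, ‖(T * gt' * Tinv) i j‖ ≤ m * (m * (M * H) * M) := norm_mul_apply_le (by positivity) h1' hTe'
  have hXe' : ∀ i j, ‖X' i j‖ ≤ m ^ 3 * M ^ 3 * H := fun i j => by
    rw [hX']
    calc ‖(κ * (T * gt' * Tinv)) i j‖ ≤ m * (M * (m * (m * (M * H) * M))) := norm_mul_apply_le hM hκe h2' i j
      _ = m ^ 3 * M ^ 3 * H := by ring
  -- invert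
  have hXu : IsUnit X := (Matrix.isUnit_iff_isUnit_det X).2 (Matrix.isUnit_det_of_right_inverse hXX')
  have hXinv : X⁻¹ = X' := Matrix.inv_eq_right_inv hXX'
  have hXie : ∀ i j, ‖X⁻¹ i j‖ ≤ m ^ 3 * M ^ 3 * H := fun i j => by rw [hXinv]; exact hXe' i j
  obtain ⟨hy, -, hyi, -⟩ := blocks_entry_le hXu hXe hXie
  have hyu : IsUnit y := (Matrix.isUnit_fromBlocks_zero₂₁.1 hXu).1
  exact ⟨hy, hyi, Matrix.mul_nonsing_inv y ((Matrix.isUnit_iff_isUnit_det y).1 hyu)⟩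

/-- `Re det(y yᴴ) = ‖det y‖²`. [folklore] -/
theorem re_det_mul_conjTranspose (y : Matrix p p ℂ) : ((y * yᴴ).det).re = ‖y.det‖ ^ 2 := by
  rw [Matrix.det_mul, Matrix.det_conjTranspose, Complex.star_def, Complex.mul_conj', ← Complex.ofReal_pow, Complex.ofReal_re]

/-- **THE DETERMINANT FACTOR**: if `y y⁻¹ = 1` and the entries of `y`, `y⁻¹` are `≤ R` (`R ≥ 0`), then for every real `A`
`(Re det(y yᴴ))^{−A} ≤ ((|p|!·R^{|p|})²)^{|A|}` (`‖det y‖, ‖det y‖⁻¹ ≤ |p|!·R^{|p|}`). [folklore] -/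
theorem rpow_neg_re_det_le {y : Matrix p p ℂ} (hy : y * y⁻¹ = 1) {R : ℝ} (he : ∀ i j, ‖y i j‖ ≤ R) (he' : ∀ i j, ‖y⁻¹ i j‖ ≤ R) (A : ℝ) :
    (((y * yᴴ).det).re) ^ (-A) ≤ ((((Fintype.card p).factorial : ℝ) * R ^ Fintype.card p) ^ 2) ^ |A| := by
  set a : ℝ := ((Fintype.card p).factorial : ℝ) * R ^ Fintype.card p with ha
  set z : ℝ := ‖y.det‖ with hz
  have hza : z ≤ a := norm_det_le_of_entry_le he
  have hdet1 : y.det * (y⁻¹).det = 1 := by rw [← Matrix.det_mul, hy, Matrix.det_one]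
  have hzi : z⁻¹ = ‖(y⁻¹).det‖ := by
    rw [hz, ← norm_inv]
    congr 1
    exact inv_eq_of_mul_eq_one_right hdet1
  have hza' : z⁻¹ ≤ a := by rw [hzi]; exact norm_det_le_of_entry_le he'
  have hz0 : 0 < z := by
    rw [hz]
    exact norm_pos_iff.2 fun h0 => by simp [h0] at hdet1
  have ha0 : 0 ≤ a := hz0.le.trans hza
  rw [re_det_mul_conjTranspose, ← hz]
  have hz2 : 0 ≤ z ^ 2 := sq_nonneg z
  rcases le_or_gt 0 A with hA | hA
  · -- `A ≥ 0`: `(z²)^{−A} = ((z²)⁻¹)^A ≤ (a²)^A`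
    rw [abs_of_nonneg hA, Real.rpow_neg hz2, ← Real.inv_rpow hz2]
    refine Real.rpow_le_rpow (by positivity) ?_ hA
    rw [← inv_pow]
    exact pow_le_pow_left₀ (by positivity) hza' 2
  · -- `A < 0`: `(z²)^{−A} ≤ (a²)^{−A}`
    rw [abs_of_neg hA]
    exact Real.rpow_le_rpow hz2 (pow_le_pow_left₀ hz0.le hza 2) (by linarith)

end Place

/-! ## §2 The faces Φ9 consumes -/

section Face

open NumberField NumberField.mixedEmbedding NumberField.InfinitePlace IsDedekindDomain
open Literature.NumberTheory.Automorphic Literature.NumberTheory.Automorphic.UnitaryGroup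
open Summit.HodgeConjecture.HodgeConjecture.Cruxes.HLiu418.K2LiuArchOneParameterOrbitHeight (exists_pos_height_mul_le)

variable (F E : Type) [Field F] [NumberField F] [Field E] [NumberField E] [Algebra F E] (c : E ≃ₐ[F] E) (N : ℕ) (J : Matrix (Fin N) (Fin N) E)

/-- a universal floor for the adelic height on `GL_N(𝔸_E)`, `N ≥ 1` (`‖1‖ = ‖g g⁻¹‖ ≤ C‖g‖‖g⁻¹‖ = C‖g‖²`). [cite: BorelJacquet1979, §1.2 (properties (i), (ii))] -/
theorem exists_adelicHeightGL_floor [NeZero N] :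
    ∃ c₀ : ℝ, 0 < c₀ ∧ ∀ g : GL (Fin N) (AdeleRing (𝓞 E) E), c₀ ≤ adelicHeightGL N E g := by
  obtain ⟨C, hC0, hC⟩ := exists_pos_height_mul_le (n := N) (K := E)
  have h1 : 0 < adelicHeightGL N E (1 : GL (Fin N) (AdeleRing (𝓞 E) E)) := adelicHeightGL_pos_holds 1
  refine ⟨Real.sqrt (adelicHeightGL N E (1 : GL (Fin N) (AdeleRing (𝓞 E) E)) / C), Real.sqrt_pos.2 (div_pos h1 hC0), fun g => ?_⟩
  have hg0 : 0 ≤ adelicHeightGL N E g := adelicHeightGL_nonneg _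
  have h2 := (hC g g⁻¹).1
  rw [mul_inv_cancel, adelicHeightGL_inv] at h2
  have h3 : adelicHeightGL N E (1 : GL (Fin N) (AdeleRing (𝓞 E) E)) / C ≤ adelicHeightGL N E g ^ 2 := by
    rw [div_le_iff₀ hC0]; nlinarith
  calc Real.sqrt (adelicHeightGL N E (1 : GL (Fin N) (AdeleRing (𝓞 E) E)) / C) ≤ Real.sqrt (adelicHeightGL N E g ^ 2) := Real.sqrt_le_sqrt h3
    _ = adelicHeightGL N E g := Real.sqrt_sq hg0

variable {S p : Type*} [Fintype S] [Fintype p] [DecidableEq p]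

/-- **FACE 1 — THE LATTICE SUM AGAINST THE HEIGHT.**  Frame data BY VALUE: complex places `w σ` fixed by `c ≠ 1`, `r : p ⊕ p ≃ Fin N` (`N ≥ 1`, `p` nonempty),
frames `T σ, T σ⁻¹`, one bound `M ≥ 1` for the entries of the frames and the movers, a full discrete `ℤ`-lattice `Λ ⊂ S → M_p(ℂ)`, a real exponent `N′ ≥ 0`.
CONCLUSION: `∃ C A′, ∀ h y b d κ κ′` with movers `κ σ κ′ σ = 1 = κ′ σ κ σ` of entries `≤ M` and the BLOCK DECOMPOSITION
`hdec : T σ · (h_∞)~_{w σ} · T σ⁻¹ = [y σ, b σ; 0, d σ] · κ σ` (any such):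
`Σ'_{x ∈ Λ, x ≻ 0} ∏_σ e^{−2π Re tr(x_σ · y_σ y_σᴴ)} (1 + Re tr x_σ)^{N′} ≤ C · ‖h‖^{A′}` (and the series is summable).
[cite: MoeglinWaldspurger1995, I.2.2, II.1.5] [cite: BorelJacquet1979, §1.2, §4.1] [cite: Shimura1997, §A3] -/
theorem latticeSum_le_height [NeZero N] [Nonempty p] (hc : c ≠ 1) (w : S → {w : InfinitePlace E // IsComplex w}) (hw : ∀ σ, c • (w σ).1 = (w σ).1)
    (r : p ⊕ p ≃ Fin N) (T Tinv : S → Matrix (p ⊕ p) (p ⊕ p) ℂ) (hT : ∀ σ, T σ * Tinv σ = 1) (hT' : ∀ σ, Tinv σ * T σ = 1)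
    {M : ℝ} (hM : 1 ≤ M) (hTe : ∀ σ i j, ‖T σ i j‖ ≤ M) (hTe' : ∀ σ i j, ‖Tinv σ i j‖ ≤ M)
    (Λ : Submodule ℤ (S → (p → p → ℂ))) [DiscreteTopology Λ] [IsZLattice ℝ Λ] {N' : ℝ} (hN' : 0 ≤ N') :
    ∃ C A' : ℝ, 0 ≤ C ∧ ∀ (h : (adelicGroupData F E c N J).Adelic) (y b d : S → Matrix p p ℂ) (κ κ' : S → Matrix (p ⊕ p) (p ⊕ p) ℂ),
      (∀ σ, κ σ * κ' σ = 1) → (∀ σ, κ' σ * κ σ = 1) → (∀ σ i j, ‖κ σ i j‖ ≤ M) → (∀ σ i j, ‖κ' σ i j‖ ≤ M) →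
      (∀ σ, T σ * Matrix.reindex r.symm r.symm
          ((((archAt F E c N J (w σ) (hw σ) hc (archPart F E c N J h) : archLocal E N J (w σ)) : GL (Fin N) ℂ) : Matrix (Fin N) (Fin N) ℂ)) *
          Tinv σ = Matrix.fromBlocks (y σ) (b σ) 0 (d σ) * κ σ) →
      Summable (fun x : {x : Λ // ∀ σ, (Matrix.of ((x : S → (p → p → ℂ)) σ)).PosDef} =>
        ∏ σ, (Real.exp (-(2 * Real.pi * ((Matrix.of (((x : Λ) : S → (p → p → ℂ)) σ) * (y σ * (y σ)ᴴ)).trace).re)) *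
          (1 + ((Matrix.of (((x : Λ) : S → (p → p → ℂ)) σ)).trace).re) ^ N')) ∧
      ∑' x : {x : Λ // ∀ σ, (Matrix.of ((x : S → (p → p → ℂ)) σ)).PosDef},
        ∏ σ, (Real.exp (-(2 * Real.pi * ((Matrix.of (((x : Λ) : S → (p → p → ℂ)) σ) * (y σ * (y σ)ᴴ)).trace).re)) *
          (1 + ((Matrix.of (((x : Λ) : S → (p → p → ℂ)) σ)).trace).re) ^ N') ≤
        C * adelicHeightGL N E (adelicVal F E c N J h) ^ A' := by
  obtain ⟨C₀, k, hC₀, hlat⟩ := exists_tsum_lattice_posDef_trace_le Λ hN'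
  obtain ⟨c₀, hc₀, hfloor⟩ := exists_adelicHeightGL_floor E N
  -- constants
  set cB : ℝ := (Fintype.card (p ⊕ p) : ℝ) ^ 3 * M ^ 3 with hcB
  have hcB0 : 0 ≤ cB := by positivity
  set cE : ℝ := (Fintype.card p : ℝ) * (cB + c₀⁻¹) with hcE
  have hcE0 : 0 ≤ cE := by positivity
  refine ⟨C₀ * (cE ^ 2) ^ k, 2 * k, by positivity, fun h y b d κ κ' hκ hκ' hκe hκe' hdec => ?_⟩
  set H : ℝ := adelicHeightGL N E (adelicVal F E c N J h) with hH
  have hHc : c₀ ≤ H := hfloor _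
  have hH0 : 0 < H := lt_of_lt_of_le hc₀ hHc
  have hM0 : 0 ≤ M := zero_le_one.trans hM
  -- per place: entries of `y σ`, `(y σ)⁻¹` and the floor `y yᴴ ⪰ ε•1`
  have hblk : ∀ σ, (∀ i j, ‖y σ i j‖ ≤ cB * H) ∧ (∀ i j, ‖(y σ)⁻¹ i j‖ ≤ cB * H) ∧ y σ * (y σ)⁻¹ = 1 := by
    intro σ
    have hg := norm_archAt_archPart_apply_le F E c N J (w σ) (hw σ) hc h
    have hmul : ((((archAt F E c N J (w σ) (hw σ) hc (archPart F E c N J h) : archLocal E N J (w σ)) : GL (Fin N) ℂ) : Matrix (Fin N) (Fin N) ℂ)) *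
        ((((archAt F E c N J (w σ) (hw σ) hc (archPart F E c N J h))⁻¹ : archLocal E N J (w σ)) : GL (Fin N) ℂ) : Matrix (Fin N) (Fin N) ℂ) = 1 := by
      rw [Subgroup.coe_inv, Matrix.coe_units_inv, Matrix.mul_nonsing_inv _ (Matrix.isUnits_det_units _)]
    exact block_entry_bounds r (hT σ) (hT' σ) (hκ σ) (hκ' σ) hM0 (hTe σ) (hTe' σ) (hκe σ) (hκe' σ) hmul hH0.le
      (fun i j => (hg i j).1) (fun i j => (hg i j).2) (hdec σ)
  -- the decay rate `ε = (|p| (cB H + 1))⁻²`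
  set R : ℝ := cB * H + 1 with hR
  have hR1 : 1 ≤ R := by rw [hR]; nlinarith [mul_nonneg hcB0 hH0.le]
  have hp1 : (1 : ℝ) ≤ Fintype.card p := by exact_mod_cast Fintype.card_pos
  set ε : ℝ := ((((Fintype.card p : ℝ) * R) ^ 2)⁻¹) with hε
  have hpR : 1 ≤ (Fintype.card p : ℝ) * R := by nlinarith
  have hε0 : 0 < ε := by positivity
  have hε1 : ε ≤ 1 := by
    have h1 : (1 : ℝ) ≤ ((Fintype.card p : ℝ) * R) ^ 2 := by nlinarith
    rw [hε]; exact inv_le_one_of_one_le₀ h1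
  have hg : ∀ σ, (y σ * (y σ)ᴴ - (ε : ℂ) • (1 : Matrix p p ℂ)).PosSemidef := fun σ =>
    posSemidef_mul_conjTranspose_sub_smul (hblk σ).2.2 fun i j => ((hblk σ).2.1 i j).trans (by rw [hR]; linarith)
  obtain ⟨hs, hle⟩ := hlat ε hε0 hε1 (fun σ => y σ * (y σ)ᴴ) hg
  refine ⟨hs, hle.trans ?_⟩
  -- `C₀ / ε^k ≤ C₀ (cE²)^k H^{2k}`
  have hinv : ε⁻¹ ≤ cE ^ 2 * H ^ 2 := by
    rw [hε, inv_inv]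
    have h1 : (Fintype.card p : ℝ) * R ≤ cE * H := by
      rw [hcE, hR]
      have h3 : 1 ≤ c₀⁻¹ * H := by rw [inv_mul_eq_div, le_div_iff₀ hc₀]; linarith
      have h2 : cB * H + 1 ≤ (cB + c₀⁻¹) * H := by nlinarith
      calc (Fintype.card p : ℝ) * (cB * H + 1) ≤ (Fintype.card p : ℝ) * ((cB + c₀⁻¹) * H) :=
            mul_le_mul_of_nonneg_left h2 (Nat.cast_nonneg _)
        _ = (Fintype.card p : ℝ) * (cB + c₀⁻¹) * H := by ring
    calc ((Fintype.card p : ℝ) * R) ^ 2 ≤ (cE * H) ^ 2 := pow_le_pow_left₀ (by positivity) h1 2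
      _ = cE ^ 2 * H ^ 2 := by ring
  have hrp : H ^ ((2 * k : ℕ) : ℝ) = (H ^ 2) ^ k := by rw [Real.rpow_natCast, pow_mul]
  calc C₀ / ε ^ k = C₀ * (ε⁻¹) ^ k := by rw [div_eq_mul_inv, ← inv_pow]
    _ ≤ C₀ * (cE ^ 2 * H ^ 2) ^ k := mul_le_mul_of_nonneg_left (pow_le_pow_left₀ (by positivity) hinv k) hC₀
    _ = C₀ * (cE ^ 2) ^ k * H ^ ((2 * k : ℕ) : ℝ) := by rw [hrp, mul_pow]; ring
    _ = C₀ * (cE ^ 2) ^ k * adelicHeightGL N E (adelicVal F E c N J h) ^ ((2 * (k : ℝ))) := by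
        rw [hH]; norm_cast

/-- **FACE 2 — THE DETERMINANT FACTOR AGAINST THE HEIGHT**: with the same frame data and ANY block decomposition `hdec`, for every real `A`:
`∏_σ (Re det(y_σ y_σᴴ))^{−A} ≤ C · ‖h‖^{A′}`. [cite: BorelJacquet1979, §1.2, §4.1] [cite: MoeglinWaldspurger1995, I.2.2] -/
theorem detFactor_le_height [NeZero N] (hc : c ≠ 1) (w : S → {w : InfinitePlace E // IsComplex w}) (hw : ∀ σ, c • (w σ).1 = (w σ).1)
    (r : p ⊕ p ≃ Fin N) (T Tinv : S → Matrix (p ⊕ p) (p ⊕ p) ℂ) (hT : ∀ σ, T σ * Tinv σ = 1) (hT' : ∀ σ, Tinv σ * T σ = 1)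
    {M : ℝ} (hM : 1 ≤ M) (hTe : ∀ σ i j, ‖T σ i j‖ ≤ M) (hTe' : ∀ σ i j, ‖Tinv σ i j‖ ≤ M) (A : ℝ) :
    ∃ C A' : ℝ, 0 ≤ C ∧ ∀ (h : (adelicGroupData F E c N J).Adelic) (y b d : S → Matrix p p ℂ) (κ κ' : S → Matrix (p ⊕ p) (p ⊕ p) ℂ),
      (∀ σ, κ σ * κ' σ = 1) → (∀ σ, κ' σ * κ σ = 1) → (∀ σ i j, ‖κ σ i j‖ ≤ M) → (∀ σ i j, ‖κ' σ i j‖ ≤ M) →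
      (∀ σ, T σ * Matrix.reindex r.symm r.symm
          ((((archAt F E c N J (w σ) (hw σ) hc (archPart F E c N J h) : archLocal E N J (w σ)) : GL (Fin N) ℂ) : Matrix (Fin N) (Fin N) ℂ)) *
          Tinv σ = Matrix.fromBlocks (y σ) (b σ) 0 (d σ) * κ σ) →
      ∏ σ, (((y σ * (y σ)ᴴ).det).re) ^ (-A) ≤ C * adelicHeightGL N E (adelicVal F E c N J h) ^ A' := by
  obtain ⟨c₀, hc₀, hfloor⟩ := exists_adelicHeightGL_floor E N
  set cB : ℝ := (Fintype.card (p ⊕ p) : ℝ) ^ 3 * M ^ 3 with hcB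
  have hcB0 : 0 ≤ cB := by positivity
  set m : ℕ := Fintype.card p with hm
  -- per-place constant `K = ((m! cB^m)²)^{|A|}` and exponent `2 m |A|`
  set K : ℝ := ((((m.factorial : ℝ) * cB ^ m) ^ 2) ^ |A|) with hK
  have hK0 : 0 ≤ K := by positivity
  refine ⟨K ^ Fintype.card S, (Fintype.card S : ℝ) * (2 * m * |A|), by positivity, fun h y b d κ κ' hκ hκ' hκe hκe' hdec => ?_⟩
  set H : ℝ := adelicHeightGL N E (adelicVal F E c N J h) with hH
  have hHc : c₀ ≤ H := hfloor _
  have hH0 : 0 < H := lt_of_lt_of_le hc₀ hHc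
  have hM0 : 0 ≤ M := zero_le_one.trans hM
  have hblk : ∀ σ, (∀ i j, ‖y σ i j‖ ≤ cB * H) ∧ (∀ i j, ‖(y σ)⁻¹ i j‖ ≤ cB * H) ∧ y σ * (y σ)⁻¹ = 1 := by
    intro σ
    have hg := norm_archAt_archPart_apply_le F E c N J (w σ) (hw σ) hc h
    have hmul : ((((archAt F E c N J (w σ) (hw σ) hc (archPart F E c N J h) : archLocal E N J (w σ)) : GL (Fin N) ℂ) : Matrix (Fin N) (Fin N) ℂ)) *
        ((((archAt F E c N J (w σ) (hw σ) hc (archPart F E c N J h))⁻¹ : archLocal E N J (w σ)) : GL (Fin N) ℂ) : Matrix (Fin N) (Fin N) ℂ) = 1 := by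
      rw [Subgroup.coe_inv, Matrix.coe_units_inv, Matrix.mul_nonsing_inv _ (Matrix.isUnits_det_units _)]
    exact block_entry_bounds r (hT σ) (hT' σ) (hκ σ) (hκ' σ) hM0 (hTe σ) (hTe' σ) (hκe σ) (hκe' σ) hmul hH0.le
      (fun i j => (hg i j).1) (fun i j => (hg i j).2) (hdec σ)
  -- per place: `(Re det)^{−A} ≤ K · H^{2m|A|}`
  have hplace : ∀ σ, (((y σ * (y σ)ᴴ).det).re) ^ (-A) ≤ K * H ^ (2 * m * |A|) := by
    intro σ
    have h1 := rpow_neg_re_det_le (hblk σ).2.2 (hblk σ).1 (hblk σ).2.1 A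
    refine h1.trans (le_of_eq ?_)
    -- `((m!·(cB H)^m)²)^{|A|} = ((m! cB^m)²)^{|A|} · H^{2 m |A|}`
    have hsplit : (((m.factorial : ℝ) * (cB * H) ^ m) ^ 2) = (((m.factorial : ℝ) * cB ^ m) ^ 2) * (H ^ 2) ^ m := by ring
    rw [hsplit, Real.mul_rpow (by positivity) (by positivity), hK]
    congr 1
    rw [← Real.rpow_natCast (H ^ 2) m, ← Real.rpow_natCast H 2, ← Real.rpow_mul hH0.le, ← Real.rpow_mul hH0.le]
    norm_num
  have hplace0 : ∀ σ, 0 ≤ (((y σ * (y σ)ᴴ).det).re) ^ (-A) := fun σ => by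
    rw [re_det_mul_conjTranspose]; exact Real.rpow_nonneg (sq_nonneg _) _
  calc ∏ σ, (((y σ * (y σ)ᴴ).det).re) ^ (-A) ≤ ∏ _σ : S, K * H ^ (2 * m * |A|) :=
        Finset.prod_le_prod (fun σ _ => hplace0 σ) fun σ _ => hplace σ
    _ = (K * H ^ (2 * m * |A|)) ^ Fintype.card S := by rw [Finset.prod_const, Finset.card_univ]
    _ = K ^ Fintype.card S * H ^ ((Fintype.card S : ℝ) * (2 * m * |A|)) := by
        rw [mul_pow, ← Real.rpow_natCast (H ^ (2 * (m : ℝ) * |A|)), ← Real.rpow_mul hH0.le, mul_comm (2 * (m : ℝ) * |A|)]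

/-- **THE FACE Φ9 CONSUMES (product form)**: lattice sum × determinant factor `≤ C · ‖h‖^{A′}` for every `h` and every block decomposition (faces 1 and 2).
[cite: MoeglinWaldspurger1995, I.2.2, II.1.5] [cite: BorelJacquet1979, §1.2, §4.1] -/
theorem latticeSum_mul_detFactor_le_height [NeZero N] [Nonempty p] (hc : c ≠ 1) (w : S → {w : InfinitePlace E // IsComplex w})
    (hw : ∀ σ, c • (w σ).1 = (w σ).1)
    (r : p ⊕ p ≃ Fin N) (T Tinv : S → Matrix (p ⊕ p) (p ⊕ p) ℂ) (hT : ∀ σ, T σ * Tinv σ = 1) (hT' : ∀ σ, Tinv σ * T σ = 1)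
    {M : ℝ} (hM : 1 ≤ M) (hTe : ∀ σ i j, ‖T σ i j‖ ≤ M) (hTe' : ∀ σ i j, ‖Tinv σ i j‖ ≤ M)
    (Λ : Submodule ℤ (S → (p → p → ℂ))) [DiscreteTopology Λ] [IsZLattice ℝ Λ] {N' : ℝ} (hN' : 0 ≤ N') (A : ℝ) :
    ∃ C A' : ℝ, 0 ≤ C ∧ ∀ (h : (adelicGroupData F E c N J).Adelic) (y b d : S → Matrix p p ℂ) (κ κ' : S → Matrix (p ⊕ p) (p ⊕ p) ℂ),
      (∀ σ, κ σ * κ' σ = 1) → (∀ σ, κ' σ * κ σ = 1) → (∀ σ i j, ‖κ σ i j‖ ≤ M) → (∀ σ i j, ‖κ' σ i j‖ ≤ M) →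
      (∀ σ, T σ * Matrix.reindex r.symm r.symm
          ((((archAt F E c N J (w σ) (hw σ) hc (archPart F E c N J h) : archLocal E N J (w σ)) : GL (Fin N) ℂ) : Matrix (Fin N) (Fin N) ℂ)) *
          Tinv σ = Matrix.fromBlocks (y σ) (b σ) 0 (d σ) * κ σ) →
      (∑' x : {x : Λ // ∀ σ, (Matrix.of ((x : S → (p → p → ℂ)) σ)).PosDef},
        ∏ σ, (Real.exp (-(2 * Real.pi * ((Matrix.of (((x : Λ) : S → (p → p → ℂ)) σ) * (y σ * (y σ)ᴴ)).trace).re)) *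
          (1 + ((Matrix.of (((x : Λ) : S → (p → p → ℂ)) σ)).trace).re) ^ N')) *
        ∏ σ, (((y σ * (y σ)ᴴ).det).re) ^ (-A) ≤ C * adelicHeightGL N E (adelicVal F E c N J h) ^ A' := by
  obtain ⟨C₁, A₁, hC₁, h₁⟩ := latticeSum_le_height F E c N J hc w hw r T Tinv hT hT' hM hTe hTe' Λ hN'
  obtain ⟨C₂, A₂, hC₂, h₂⟩ := detFactor_le_height F E c N J hc w hw r T Tinv hT hT' hM hTe hTe' A
  refine ⟨C₁ * C₂, A₁ + A₂, mul_nonneg hC₁ hC₂, fun h y b d κ κ' hκ hκ' hκe hκe' hdec => ?_⟩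
  obtain ⟨hs, hle⟩ := h₁ h y b d κ κ' hκ hκ' hκe hκe' hdec
  have hle₂ := h₂ h y b d κ κ' hκ hκ' hκe hκe' hdec
  obtain ⟨c₀, hc₀, hfloor⟩ := exists_adelicHeightGL_floor E N
  have hHpos : 0 < adelicHeightGL N E (adelicVal F E c N J h) := lt_of_lt_of_le hc₀ (hfloor _)
  have hS0 : 0 ≤ ∑' x : {x : Λ // ∀ σ, (Matrix.of ((x : S → (p → p → ℂ)) σ)).PosDef},
      ∏ σ, (Real.exp (-(2 * Real.pi * ((Matrix.of (((x : Λ) : S → (p → p → ℂ)) σ) * (y σ * (y σ)ᴴ)).trace).re)) *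
        (1 + ((Matrix.of (((x : Λ) : S → (p → p → ℂ)) σ)).trace).re) ^ N') :=
    tsum_nonneg fun x => Finset.prod_nonneg fun σ _ => mul_nonneg (Real.exp_pos _).le (Real.rpow_nonneg (by
      have := norm_apply_le_re_trace_of_posDef (x.2 σ)
      by_cases hp : Nonempty p
      · obtain ⟨i⟩ := hp; linarith [(norm_nonneg _).trans (this i i)]
      · exact absurd ‹Nonempty p› hp) _)
  have hD0 : 0 ≤ ∏ σ, (((y σ * (y σ)ᴴ).det).re) ^ (-A) :=
    Finset.prod_nonneg fun σ _ => by rw [re_det_mul_conjTranspose]; exact Real.rpow_nonneg (sq_nonneg _) _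
  calc _ ≤ (C₁ * adelicHeightGL N E (adelicVal F E c N J h) ^ A₁) * (C₂ * adelicHeightGL N E (adelicVal F E c N J h) ^ A₂) :=
        mul_le_mul hle hle₂ hD0 (by positivity)
    _ = C₁ * C₂ * adelicHeightGL N E (adelicVal F E c N J h) ^ (A₁ + A₂) := by
        rw [Real.rpow_add hHpos]; ring

end Face

end Summit.HodgeConjecture.HodgeConjecture.Cruxes.HLiu418.K2LiuIwasawaHeightLatticeSumBound

end
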